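import Summits.SmoothPoincare4.SmoothPoincare4.Statement
import Literature.Topology.FourManifolds.FreeS3ActionsSevenSphere
import HarnessLib
import HarnessLib.Audit

/-!
# SoloBlindFreeS3Actions — SPC4 ⇔ rigidity of free smooth `S³`-actions on `S⁷`

Seat `solo-SmoothPoincare4-blind` (ideation tier, soloist, BLIND mode), 2026-08-18. Informal
companion with full proofs: `run/shared/lean/ideation/SmoothPoincare4/solo-blind/paper/
total-space-reformulations.md`, Theorems A and B.

Content. Over the definitions of `Literature.Topology.FourManifolds.FreeS3ActionS7`
(free `C^∞` actions of the unit quaternions on the standard `S⁷`, conjugacy `IsConj`, orbit maps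
`IsOrbitMap`):

* `HomotopySphereFourIsOrbitSpace` — **Theorem A of the write-up, a CLAIM of this seat under
  adjudication** (stated as a `Prop`, used only as a hypothesis): every smooth homotopy 4-sphere is
  the orbit space of a free smooth `S³`-action on the STANDARD `S⁷` (the principal `SU(2)`-bundle
  with `c₂ = ±1` over it has total space `S⁷`, by an Eells–Kuiper `μ`-invariant computation).
* `FreeS3ActionsS7Unique` — UNIQ: any two free smooth `S³`-actions on `S⁷` are conjugate.
* `smoothPoincare4_iff_freeS3ActionsS7Unique` — `SmoothPoincare4 ↔ FreeS3ActionsS7Unique`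
  modulo five explicit hypotheses: Theorem A and the four textbook named facts of the Literature
  file (orbit spaces exist and are homotopy 4-spheres; conjugacies descend; the Hopf action exists;
  Steenrod classification over `S⁴`). Both directions separately:
  `smoothPoincare4_of_freeS3ActionsS7Unique`, `freeS3ActionsS7Unique_of_smoothPoincare4`.

What this is NOT: it is not progress on SPC4. It is a kernel-checked statement of the exact
logical shape of one reformulation ("exoticness of a homotopy 4-sphere is invisible in the total
space of its `SU(2)`-bundle, so SPC4 is a rigidity statement about free `S³`-actions on one fixed
manifold `S⁷`"), with its trust base listed as hypotheses. The analogous rigidity FAILS for free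
`S³`-actions on `S¹¹, S¹⁵, …` (Hsiang 1966) and for free `S¹`-actions on high-dimensional spheres,
so the statement is specific to `S⁷`/dimension four.
-/

noncomputable section

open scoped Manifold ContDiff

namespace Summit.SmoothPoincare4.SmoothPoincare4.Theorems

open Literature.Topology.FourManifolds

/-- **Theorem A of the write-up (CLAIM of the seat `solo-SmoothPoincare4-blind`, under
adjudication; stated here as a hypothesis, never asserted).** Every smooth homotopy 4-sphere —
any `C^∞` 4-manifold structure (boundaryless model `𝓡 4`) on a Hausdorff second-countable space
homotopy equivalent to `S⁴` — is the orbit space of a free smooth `S³`-action on the STANDARD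
`S⁷`; equivalently, the principal `SU(2)`-bundle `P_Σ → Σ` with `⟨c₂, [Σ]⟩ = ±1` has total space
diffeomorphic to `S⁷`. Proof sketch (write-up, Thm. A): `P_Σ` is a homotopy 7-sphere bounding the
spin disc bundle `W = D(E)` of the quaternionic line bundle, `τ(W) = ±1`, `p₁(W) = ∓2x`
(`p₁(TΣ) = 3τ(Σ) = 0`), so the Eells–Kuiper invariant `μ = (p₁² − 4τ)/896 ≡ 0`, the value of the
standard `S⁷`, and `μ` is a complete invariant of `Θ₇ ≅ ℤ/28`; then transport the principal action
along `P_Σ ≅ S⁷`. (Basu–Kasilingam 2022, Lemma 4.3, treats orbit spaces PL-homeomorphic to `ℍPⁿ`,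
which in dimension four excludes exotic `Σ`; the exotic case is the content of the claim.)
Tagged `@[conjecture]` = an unproved statement of OUR theories (obligation node), per CONVENTIONS §4. -/
@[conjecture] def HomotopySphereFourIsOrbitSpace : Prop :=
  ∀ (M : Type) [TopologicalSpace M] [T2Space M] [SecondCountableTopology M]
    [ChartedSpace (EuclideanSpace ℝ (Fin 4)) M] [IsManifold (𝓡 4) ∞ M],
    ContinuousMap.HomotopyEquiv M (Metric.sphere (0 : EuclideanSpace ℝ (Fin (4 + 1))) 1) →
      ∃ (a : FreeS3ActionS7) (π : Metric.sphere (0 : EuclideanSpace ℝ (Fin (7 + 1))) 1 → M), a.IsOrbitMap M π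

/-- **UNIQ — rigidity of free `S³`-actions on `S⁷`** (write-up, Thm. B (ii)): any two free smooth
actions of the unit quaternions on the standard 7-sphere are conjugate by a diffeomorphism of `S⁷`
(so every one is conjugate to the Hopf action). OPEN: by the two theorems below it is equivalent to
the smooth 4-dimensional Poincaré conjecture modulo the named facts. The analogous rigidity FAILS
for free `S³`-actions on homotopy `(4n+3)`-spheres with `n ≥ 2` (Hsiang 1966: infinitely many
inequivalent ones) and for free `S¹`-actions on `S⁷` (Montgomery–Yang 1966), so the statement is
specific to `S³` acting on `S⁷`. -/
@[conjecture] def FreeS3ActionsS7Unique : Prop :=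
  ∀ a b : FreeS3ActionS7, a.IsConj b

/-- **UNIQ ⇒ SPC4** (write-up Thm. B, (ii) ⇒ (i)), modulo: Theorem A (`HomotopySphereFourIsOrbitSpace`,
the seat's claim), descent of conjugacies to orbit spaces, and the existence of the Hopf action with
orbit space `S⁴`. Given a smooth homotopy 4-sphere `M`, realise it as `S⁷/a`; `a` is conjugate to the
Hopf action `h`; hence `M = S⁷/a ≅ S⁷/h = S⁴`. -/
theorem smoothPoincare4_of_freeS3ActionsS7Unique
    (hA : HomotopySphereFourIsOrbitSpace) (hD : OrbitSpaceDiffeomorphOfIsConj)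
    (hH : ExistsHopfActionS7) (hU : FreeS3ActionsS7Unique) : SmoothPoincare4 := by
  unfold SmoothPoincare4 Literature.SPC4.SmoothPoincareConjectureFour
  intro M _ _ _
  unfold ContinuousMap.HomotopyEquiv.NonemptyDiffeomorphSphere
  intro cs im he
  obtain ⟨a, π, hπ⟩ := hA M he
  obtain ⟨h, πh, hh⟩ := hH
  exact hD a h M (Metric.sphere (0 : EuclideanSpace ℝ (Fin (4 + 1))) 1) π πh hπ hh (hU a h)

/-- **SPC4 ⇒ UNIQ** (write-up Thm. B, (i) ⇒ (ii)), modulo: existence and homotopy type of orbit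
spaces, and the classification of principal `SU(2)`-bundles over `S⁴` with total space `S⁷`.
Given free actions `a`, `b`, their orbit spaces are smooth homotopy 4-spheres, hence (SPC4) both
diffeomorphic to `S⁴`, hence `a`, `b` are conjugate. -/
theorem freeS3ActionsS7Unique_of_smoothPoincare4
    (hE : ExistsOrbitSpaceOfFreeS3ActionS7) (hC : IsConjOfOrbitSpacesSphere)
    (hS : SmoothPoincare4) : FreeS3ActionsS7Unique := by
  intro a b
  obtain ⟨M, _, _, _, _, _, πa, hπa, ⟨eM⟩⟩ := hE a
  obtain ⟨N, _, _, _, _, _, πb, hπb, ⟨eN⟩⟩ := hE b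
  have hM : Nonempty (M ≃ₘ⟮𝓡 4, 𝓡 4⟯ Metric.sphere (0 : EuclideanSpace ℝ (Fin (4 + 1))) 1) := by
    have h := hS M
    unfold ContinuousMap.HomotopyEquiv.NonemptyDiffeomorphSphere at h
    exact h _ ‹_› eM
  have hN : Nonempty (N ≃ₘ⟮𝓡 4, 𝓡 4⟯ Metric.sphere (0 : EuclideanSpace ℝ (Fin (4 + 1))) 1) := by
    have h := hS N
    unfold ContinuousMap.HomotopyEquiv.NonemptyDiffeomorphSphere at h
    exact h _ ‹_› eN
  exact hC a b M N πa πb hπa hπb hM hN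

/-- **SPC4 ⇔ UNIQ** (write-up, Theorem B (i) ⇔ (ii)): modulo the four textbook facts of
`Literature.Topology.FourManifolds` (orbit spaces, descent, Hopf, Steenrod classification) and the
seat's Theorem A, the smooth 4-dimensional Poincaré conjecture is equivalent to the rigidity of free
smooth `S³`-actions on the standard `S⁷`. Trust base = exactly the five hypotheses. -/
theorem smoothPoincare4_iff_freeS3ActionsS7Unique
    (hA : HomotopySphereFourIsOrbitSpace) (hD : OrbitSpaceDiffeomorphOfIsConj)
    (hH : ExistsHopfActionS7) (hE : ExistsOrbitSpaceOfFreeS3ActionS7)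
    (hC : IsConjOfOrbitSpacesSphere) : SmoothPoincare4 ↔ FreeS3ActionsS7Unique :=
  ⟨freeS3ActionsS7Unique_of_smoothPoincare4 hE hC,
    smoothPoincare4_of_freeS3ActionsS7Unique hA hD hH⟩

end Summit.SmoothPoincare4.SmoothPoincare4.Theorems
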